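import Mathlib
import HarnessLib
import Summits.HubbardSuperconductivity.HubbardSuperconductivity.Theses.KLProgramme
import Summits.HubbardSuperconductivity.HubbardSuperconductivity.Theorems.KLProgrammeKLRegimeEngineScaleZeroV17FRaiseGeo
import Summits.HubbardSuperconductivity.HubbardSuperconductivity.Theorems.KLProgrammeKLRegimeEngineV8GridLiteralsPkg
import Summits.HubbardSuperconductivity.HubbardSuperconductivity.Theorems.KLProgrammeKLRegimeEngineV8DefsU12b

/-!
# K3 ENGINE (stmt-HubbardSuperconductivity-20437 `KLRegimeEngineV17F2`), v2 FREEZE skeleton b755cc8a5feed069 (registered 2026-08-28T19:45:50Z):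
# THE TOKEN-ONLY STUBS (a) `stub_engine_scale0` AND (M) `stub_twoLeg_scale0` PROVED BY NAME + REGISTERED SIGNATURE (registrant p1b g15)

Both statements are the FROZEN image's stub texts VERBATIM (rows f36cd226253a / 407c2d80dbb1 of elect table 0be899730fd4cb25).  Proofs = p1b g14's landed closers at the
rev-13/14 tokens (…ScaleZeroV17FRaiseGeo, p609156: `stub_engine_scale0_klEng11Q9c_U10L4`, `stub_twoLeg_scale0_klEng11Q9c_U10L4`) composed with the chain heads of the
AMENDMENT 23 (α″) texts (`klEngC₃7_le_klEngC₃6`, …GridLiteralsPkg p661328; `klEngU₀12_le_klEngU₀10`, …EngineV8DefsU12b p661651) — the §Z-aM rehearsal of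
503f654139fefa2f (`type_of%`-checked against the image).  Proofs only; nothing about the model is asserted beyond these two scale-0 statements' derivation from landed
theorems; nothing asserts (b), (C), (c), (X), (e), K3, the theorem half or superconductivity.
Namespace `…Theorems.EngineV8.FreezeV2` (the short names are the registered stub names; `…EngineV8.stub_twoLeg_scale0` is taken by the v1-signature closer p547354).
-/

noncomputable section

namespace Summit.HubbardSuperconductivity.HubbardSuperconductivity.Theorems.EngineV8.FreezeV2

set_option linter.dupNamespace false -- summit = problem name (single-conjunct summit), D-0017

open Real Finset Literature.MathematicalPhysics.QuantumLattice Literature.Probability.LatticeModels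
open Summit.HubbardSuperconductivity.HubbardSuperconductivity.Theorems.KLRegimeSplit
open Summit.HubbardSuperconductivity.HubbardSuperconductivity.Theorems.KLProgrammeLegKernels
open Summit.HubbardSuperconductivity.HubbardSuperconductivity.Theorems.DispersionFlow

/-- **STUB (a) OF THE v2 FREEZE SKELETON, BY NAME AND REGISTERED SIGNATURE** (row f36cd226253a): the scale-0 engine slot at the frozen tokens
`(klEngGeo11, klEngQ9c P R, klEngC₃7 P R, klEngU₀12 P R c, klEngL₄)` — from `stub_engine_scale0_klEng11Q9c_U10L4` through the chain heads. -/
theorem stub_engine_scale0 :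
    ∀ (P : SplitConsts) (R : RenConsts) (c : ℝ), P.WF → R.WF2 → 0 < c → c ≤ klEngC₃7 P R →
      ∀ μ ∈ klWindowC, ∀ U : ℝ, 0 < U → U ≤ klEngU₀12 P R c → ∀ β : ℝ, klBetaMin ≤ β → β ≤ Real.exp (c / U ^ 2) →
        ∀ (L M : ℕ) [NeZero L] [NeZero M], klEngL₄ P R β U ≤ L → klEngM₃ β U L ≤ M →
          FrameOK R U (nScales β) μ (klFlowFrameU L M β U μ 0) →
            KernelNormsV4 L M P (klEngQ9c P R) β U μ (klFlowFrameU L M β U μ 0) 0 ∧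
              PairLadderStepAtV17F2 L M klEngGeo11 P (klEngQ9c P R) β U μ 0 ∧
                QuarticValueUVAtV17F L M klEngGeo11 P (klEngQ9c P R) β U μ 0 ∧
                  EngineFirstMoments L M klEngGeo11 P (klEngQ9c P R) β U μ (klFlowFrameU L M β U μ 0) 0 ∧
                    IsoTupleL1AtV17F L M klEngGeo11 P β U μ 0 :=
  fun P R c hP hR hc hc3 μ hμ U hU hUle β hβ hβc L M _ _ hL hM hfr =>
    stub_engine_scale0_klEng11Q9c_U10L4 P R c hP hR hc (hc3.trans (klEngC₃7_le_klEngC₃6 P R)) μ hμ U hU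
      (hUle.trans (klEngU₀12_le_klEngU₀10 P R c)) β hβ hβc L M hL hM hfr

/-- **STUB (M) OF THE v2 FREEZE SKELETON, BY NAME AND REGISTERED SIGNATURE** (row 407c2d80dbb1): the scale-0 two-leg step at the frozen tokens — from
`stub_twoLeg_scale0_klEng11Q9c_U10L4` through the chain heads. -/
theorem stub_twoLeg_scale0 :
    ∀ (P : SplitConsts) (R : RenConsts) (c : ℝ), P.WF → R.WF2 → 0 < c → c ≤ klEngC₃7 P R →
      ∀ μ ∈ klWindowC, ∀ U : ℝ, 0 < U → U ≤ klEngU₀12 P R c → ∀ β : ℝ, klBetaMin ≤ β → β ≤ Real.exp (c / U ^ 2) →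
        ∀ (L M : ℕ) [NeZero L] [NeZero M], klEngL₄ P R β U ≤ L → klEngM₃ β U L ≤ M →
          FrameOK R U (nScales β) μ (klFlowFrameU L M β U μ 0) →
            EngineBoundsAtV17F2 L M klEngGeo11 P (klEngQ9c P R) β U μ 0 →
              TwoLegReadJetBound L M klC4aJetC2 (klC4aJetC' P R) β U μ (klFlowFrameU L M β U μ 0) 0 →
                TwoLegStepV17F2 L M klEngGeo11 P (klEngQ9c P R) R β U μ 0 :=
  fun P R c hP hR hc hc3 μ hμ U hU hUle β hβ hβc L M _ _ hL hM hfr hE hJ =>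
    stub_twoLeg_scale0_klEng11Q9c_U10L4 P R c hP hR hc (hc3.trans (klEngC₃7_le_klEngC₃6 P R)) μ hμ U hU
      (hUle.trans (klEngU₀12_le_klEngU₀10 P R c)) β hβ hβc L M hL hM hfr hE hJ

end Summit.HubbardSuperconductivity.HubbardSuperconductivity.Theorems.EngineV8.FreezeV2

end
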